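import Summits.CriticalPhenomena.SAWScalingLimit.Theorems.SAWDevelopingMapNoFoldBoundReduction

/-!
# `NoFoldBound`, line Ideator3Sketch — the interior residual is not an easier half

Crux `NoFoldBound` (stmt-CriticalPhenomena-8296), route `SAWDevelopingMap`. The landed reduction
`noFoldBound_iff_sourceLoopBound_and_slitCoherence` (…NoFoldBoundReduction.lean) splits the crux
into the item `SourceLoopBound` (stmt-CriticalPhenomena-8300: at the SOURCE vertex the critical
returning-loop series is `≤ c < sin(π/8)`) and SLIT COHERENCE (the registered stub
`stub_slitCoherence`: vertices off the source all of whose neighbours lie in the domain).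

This file shows that the second half CONTAINS a copy of the first. Restrict slit coherence to the
domains whose source vertex `u` is a PENDANT vertex hanging off `v` (`a = {t, u}`, `t ∉ Λ`, the
only neighbour of `u` inside `Λ` is `v`; e.g. every half-plane configuration, `v` on the bottom
row, `u` the vertex below it, `t` below `u`). Then `v` is off the source with all neighbours
inside, the first arrivals at the door `{v, u}` reduce to the one-step walk `[u]` (weight of
modulus `x_c`), and there are NO first arrivals at the two other ports (every walk enters through
`u → v`). Slit coherence at `v` therefore reads `x_c (β_T + √3 x_c Z) ≤ k x_c |α_T − √3 x_c Z|`,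
`Z` the returning-loop series of `(Λ ∖ u) ∖ v` between the live ports — the source law of
`SourceLoopBound` — whence `Z ≤ (kα_T − β_T)/((1+k)√3 x_c) < sin(π/8)`:

* `pendant_loop_ineq` — the pointwise inequality from slit coherence with constant `k`;
* `sourceLoopBoundPendant_of_slitCoherence` — slit coherence (`∃ k < 1`) implies
  `∃ c < sin(π/8), Z_{(Λ∖u)∖v}({v,w₁} → {v,w₂}) ≤ c` on every simply connected `Λ` with a
  pendant source vertex `u ~ v` (both orientations, by reciprocity `loopSum_symm`).

Consequence for the route: BOTH halves of the split carry the critical rooted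
self-avoiding-polygon inequality that the prover seat of stmt-8300 graded an open problem (the
two suprema differ only in the local geometry at `u`).
-/
noncomputable section

open scoped BigOperators
open Literature.Probability.LatticeModels Literature.Probability.RandomPlanarGeometry.SAW

namespace Summit.CriticalPhenomena.SAWScalingLimit.Theorems.SAWDevelopingMapNoFoldBound

/-! ## Walks from a pendant source -/

section Pendant

variable {Λ : Finset HexVertex} {t u v : HexVertex}

/-- A walk from the boundary mid-edge `{t, u}` (`t ∉ Λ`) starts at `u`. [folklore] -/
theorem pendant_head_eq (ht : t ∉ Λ) {z : Sym2 HexVertex} (γ : HexMidEdgeSAW Λ s(t, u) z)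
    (hne : γ.verts ≠ []) : ∃ l, γ.verts = u :: l := by
  obtain ⟨y, l, hyl⟩ := List.exists_cons_of_ne_nil hne
  have hy : y ∈ s(t, u) := γ.head_mem y (by simp [hyl])
  rcases Sym2.mem_iff.1 hy with rfl | rfl
  · exact absurd (γ.subset y (by simp [hyl])) ht
  · exact ⟨l, hyl⟩

/-- If `v` is the only neighbour of `u` inside `Λ`, the second vertex of a walk from `{t, u}` is
`v`. [folklore] -/
theorem pendant_second_eq (hpend : ∀ y : HexVertex, hexGraph.Adj u y → y ∈ Λ → y = v)
    {z : Sym2 HexVertex} (γ : HexMidEdgeSAW Λ s(t, u) z) {y : HexVertex} {l : List HexVertex}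
    (h : γ.verts = u :: y :: l) : y = v := by
  have hch := γ.isChain
  rw [h] at hch
  exact hpend y (List.isChain_cons_cons.1 hch).1 (γ.subset y (by simp [h]))

/-- **No first arrivals at the live ports.** With a pendant source vertex `u ~ v`, every walk from
`{t, u}` to a port `{v, w}`, `w ≠ u`, passes through `v`. [folklore] -/
theorem pendant_mem_verts (ht : t ∉ Λ) (hv : v ∈ Λ) (huv : u ≠ v)
    (hpend : ∀ y : HexVertex, hexGraph.Adj u y → y ∈ Λ → y = v) {w : HexVertex} (hw : w ∈ Λ)
    (hwu : w ≠ u) (γ : HexMidEdgeSAW Λ s(t, u) s(v, w)) : v ∈ γ.verts := by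
  have hne : γ.verts ≠ [] := by
    intro h
    have he := γ.eq_of_nil h
    have htm : t ∈ s(v, w) := by rw [← he]; exact Sym2.mem_mk_left t u
    rcases Sym2.mem_iff.1 htm with h' | h'
    · exact ht (h' ▸ hv)
    · exact ht (h' ▸ hw)
  obtain ⟨l, hl⟩ := pendant_head_eq ht γ hne
  cases l with
  | nil =>
    exfalso
    have hlast : u ∈ s(v, w) := γ.getLast_mem u (by simp [hl])
    rcases Sym2.mem_iff.1 hlast with h' | h'
    · exact huv h'
    · exact hwu h'.symm
  | cons y l' =>
    have hy := pendant_second_eq hpend γ hl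
    subst hy
    simp [hl]

/-- **The first arrival at the door is the one-step walk.** With a pendant source vertex `u ~ v`,
a walk from `{t, u}` to the door `{v, u}` avoiding `v` is `[u]`. [folklore] -/
theorem pendant_verts_eq_singleton (ht : t ∉ Λ) (hu : u ∈ Λ) (htv : t ≠ v)
    (hpend : ∀ y : HexVertex, hexGraph.Adj u y → y ∈ Λ → y = v)
    (γ : HexMidEdgeSAW Λ s(t, u) s(v, u)) (hvγ : v ∉ γ.verts) : γ.verts = [u] := by
  have hne : γ.verts ≠ [] := by
    intro h
    have he := γ.eq_of_nil h
    have htm : t ∈ s(v, u) := by rw [← he]; exact Sym2.mem_mk_left t u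
    rcases Sym2.mem_iff.1 htm with h' | h'
    · exact htv h'
    · exact ht (h' ▸ hu)
  obtain ⟨l, hl⟩ := pendant_head_eq ht γ hne
  cases l with
  | nil => exact hl
  | cons y l' =>
    exfalso
    have hy := pendant_second_eq hpend γ hl
    subst hy
    exact hvγ (by simp [hl])

/-- The one-step walk `[u]` from the boundary mid-edge `{t, u}` to the door `{v, u}` exists.
[folklore] -/
theorem exists_pendantStep (ht : t ∉ Λ) (hu : u ∈ Λ) (htu : hexGraph.Adj u t)
    (htv : t ≠ v) : ∃ γ : HexMidEdgeSAW Λ s(t, u) s(v, u), γ.verts = [u] := by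
  have hne : s(t, u) ≠ s(v, u) := by
    rw [Ne, Sym2.eq_iff]
    rintro (⟨h, -⟩ | ⟨h, -⟩)
    · exact htv h
    · exact ht (h ▸ hu)
  refine ⟨{ verts := [u]
            subset := fun y hy => by
              rw [List.mem_singleton] at hy
              exact hy ▸ hu
            nodup := List.nodup_singleton u
            isChain := List.isChain_singleton u
            head_mem := fun y hy => by
              simp only [List.head?_cons, Option.some.injEq] at hy
              exact hy ▸ Sym2.mem_mk_right t u
            getLast_mem := fun y hy => by
              simp only [List.getLast?_singleton, Option.some.injEq] at hy
              exact hy ▸ Sym2.mem_mk_right v u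
            eq_of_nil := fun h => absurd h (List.cons_ne_nil u [])
            edges_nodup := fun _ => by simpa using hne
            fst_mem := ⟨(SimpleGraph.mem_edgeSet hexGraph).2 htu.symm, u, Sym2.mem_mk_right t u,
              hu⟩ }, rfl⟩

end Pendant

/-! ## Evaluating restricted first-arrival sums -/

/-- A restricted first-arrival sum vanishes when every walk to the port passes through `v`.
[folklore] -/
theorem sum_firstArrival_eq_zero_of_forall_mem {Λ : Finset HexVertex} {a : Sym2 HexVertex}
    {v w : HexVertex} (h : ∀ γ : HexMidEdgeSAW Λ a s(v, w), v ∈ γ.verts)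
    (G : HexMidEdgeSAW Λ a s(v, w) → ℂ) :
    (∑ γ : HexMidEdgeSAW Λ a s(v, w), if v ∉ γ.verts then G γ else 0) = 0 :=
  Finset.sum_eq_zero fun γ _ => if_neg (not_not.2 (h γ))

/-- A restricted first-arrival sum with a unique first arrival `γ₀` is its `γ₀` term. [folklore] -/
theorem sum_firstArrival_eq_single {Λ : Finset HexVertex} {a : Sym2 HexVertex} {v w : HexVertex}
    (γ₀ : HexMidEdgeSAW Λ a s(v, w)) (h₀ : v ∉ γ₀.verts)
    (huniq : ∀ γ : HexMidEdgeSAW Λ a s(v, w), v ∉ γ.verts → γ = γ₀)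
    (G : HexMidEdgeSAW Λ a s(v, w) → ℂ) :
    (∑ γ : HexMidEdgeSAW Λ a s(v, w), if v ∉ γ.verts then G γ else 0) = G γ₀ := by
  rw [Fintype.sum_eq_single γ₀ fun γ hγ => if_neg fun hv => hγ (huniq γ hv), if_pos h₀]

/-- Loop sums over equal domains agree (transport along a `Finset` equality inside the index
type). [folklore] -/
theorem loopSum_congr {Λ₁ Λ₂ : Finset HexVertex} (h : Λ₁ = Λ₂) (a z : Sym2 HexVertex) (x : ℝ) :
    (∑ δ : HexMidEdgeSAW Λ₁ a z, x ^ δ.length) = ∑ δ : HexMidEdgeSAW Λ₂ a z, x ^ δ.length := by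
  subst h
  rfl

/-! ## Slit coherence at a vertex hanging off a pendant source vertex -/

/-- **Slit coherence on pendant-source domains is the source law.** Slit coherence with constant
`k` (the hypothesis `hCoh`, verbatim the body of the registered stub `stub_slitCoherence`), applied
at the vertex `v` of a simply connected `Λ` whose source vertex `u` is pendant (`a = {t, u}`,
`t ∉ Λ`, `v` the only neighbour of `u` in `Λ`), in the positive labelling `(u, w₁, w₂)`, gives
`β_T + √3 x_c Z ≤ k |α_T − √3 x_c Z|` for the returning-loop series
`Z = Σ_{δ ⊂ (Λ∖u)∖v : {v,w₁} → {v,w₂}} x_c^{ℓ(δ)}`. [folklore] -/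
theorem pendant_loop_ineq {k : ℝ}
    (hCoh : ∀ (Λ : Finset HexVertex), hexDomainSimplyConnected Λ →
      ∀ a ∈ hexDomainBoundary Λ, ∀ v ∈ Λ, v ∉ a → (∀ u : HexVertex, hexGraph.Adj v u → u ∈ Λ) →
      ∀ w₀ w₁ w₂ : HexVertex, hexGraph.Adj v w₀ → hexGraph.Adj v w₁ → hexGraph.Adj v w₂ →
      w₀ ≠ w₁ → w₁ ≠ w₂ → w₀ ≠ w₂ →
      winding [hexMidpoint s(w₀, v), hexCenter v, hexMidpoint s(v, w₁)] = Real.pi / 3 →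
      let x : ℝ := hexCriticalFugacity
      let α : ℝ := 1 + 2 * hexCriticalFugacity * Real.cos (5 * Real.pi / 24)
      let β : ℝ := 1 + 2 * hexCriticalFugacity * Real.cos (11 * Real.pi / 24)
      let ω : ℂ := Complex.exp (2 * Real.pi * Complex.I / 3)
      let Z : (w p q : HexVertex) → HexMidEdgeSAW Λ a s(v, w) → ℝ :=
        fun w p q (γ : HexMidEdgeSAW Λ a s(v, w)) =>
        ∑ δ : HexMidEdgeSAW ((Λ \ γ.verts.toFinset).erase v) s(v, p) s(v, q), x ^ δ.length
      let B : (w p q : HexVertex) → ℂ := fun w p q =>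
        ∑ γ : HexMidEdgeSAW Λ a s(v, w), if v ∉ γ.verts then
          γ.weight x (5 / 8) * ((β + Real.sqrt 3 * x * Z w p q γ : ℝ) : ℂ) else 0
      let S : (w p q : HexVertex) → ℂ := fun w p q =>
        ∑ γ : HexMidEdgeSAW Λ a s(v, w), if v ∉ γ.verts then
          γ.weight x (5 / 8) * ((α - Real.sqrt 3 * x * Z w p q γ : ℝ) : ℂ) else 0
      ‖B w₀ w₁ w₂ + ω * B w₁ w₂ w₀ + ω ^ 2 * B w₂ w₀ w₁‖ ≤
        k * ‖S w₀ w₁ w₂ + S w₁ w₂ w₀ + S w₂ w₀ w₁‖)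
    {Λ : Finset HexVertex} (hΛ : hexDomainSimplyConnected Λ) {t u v w₁ w₂ : HexVertex}
    (ht : t ∉ Λ) (hu : u ∈ Λ) (hv : v ∈ Λ) (htu : hexGraph.Adj u t) (huv : hexGraph.Adj v u)
    (hpend : ∀ y : HexVertex, hexGraph.Adj u y → y ∈ Λ → y = v)
    (h₁ : hexGraph.Adj v w₁) (h₂ : hexGraph.Adj v w₂) (hu₁ : u ≠ w₁) (hu₂ : u ≠ w₂)
    (h₁₂ : w₁ ≠ w₂) (hw₁ : w₁ ∈ Λ) (hw₂ : w₂ ∈ Λ)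
    (hchir : winding [hexMidpoint s(u, v), hexCenter v, hexMidpoint s(v, w₁)] = Real.pi / 3) :
    (1 + 2 * hexCriticalFugacity * Real.cos (11 * Real.pi / 24)) +
        Real.sqrt 3 * hexCriticalFugacity *
          (∑ δ : HexMidEdgeSAW ((Λ.erase u).erase v) s(v, w₁) s(v, w₂),
            hexCriticalFugacity ^ δ.length) ≤
      k * |(1 + 2 * hexCriticalFugacity * Real.cos (5 * Real.pi / 24)) -
        Real.sqrt 3 * hexCriticalFugacity *
          (∑ δ : HexMidEdgeSAW ((Λ.erase u).erase v) s(v, w₁) s(v, w₂),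
            hexCriticalFugacity ^ δ.length)| := by
  have hx : 0 < hexCriticalFugacity := nfb_xc_pos
  have ha : s(t, u) ∈ hexDomainBoundary Λ :=
    ⟨(SimpleGraph.mem_edgeSet hexGraph).2 htu.symm, t, u, rfl, hu, ht⟩
  have htv : t ≠ v := fun h => ht (h ▸ hv)
  have hva : v ∉ s(t, u) := by
    rw [Sym2.mem_iff]
    rintro (h | h)
    · exact htv h.symm
    · exact huv.ne h
  have hint : ∀ y : HexVertex, hexGraph.Adj v y → y ∈ Λ := by
    intro y hy
    rcases SourceLoopBound.eq_or_eq_or_eq_of_adj huv h₁ h₂ hu₁ hu₂ h₁₂ hy with rfl | rfl | rfl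
    · exact hu
    · exact hw₁
    · exact hw₂
  have H := hCoh Λ hΛ _ ha v hv hva hint u w₁ w₂ huv h₁ h₂ hu₁ h₁₂ hu₂ hchir
  dsimp only at H
  -- no first arrivals at the live ports `w₁`, `w₂`
  have hm₁ : ∀ γ : HexMidEdgeSAW Λ s(t, u) s(v, w₁), v ∈ γ.verts :=
    pendant_mem_verts ht hv huv.ne.symm hpend hw₁ hu₁.symm
  have hm₂ : ∀ γ : HexMidEdgeSAW Λ s(t, u) s(v, w₂), v ∈ γ.verts :=
    pendant_mem_verts ht hv huv.ne.symm hpend hw₂ hu₂.symm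
  -- the unique first arrival at the door `u`
  obtain ⟨γ₀, hγ₀⟩ := exists_pendantStep (v := v) ht hu htu htv
  have h₀ : v ∉ γ₀.verts := by
    rw [hγ₀, List.mem_singleton]
    exact huv.ne
  have huniq : ∀ γ : HexMidEdgeSAW Λ s(t, u) s(v, u), v ∉ γ.verts → γ = γ₀ := fun γ hγ =>
    HexMidEdgeSAW.ext ((pendant_verts_eq_singleton ht hu htv hpend γ hγ).trans hγ₀.symm)
  rw [sum_firstArrival_eq_zero_of_forall_mem hm₁, sum_firstArrival_eq_zero_of_forall_mem hm₁,
    sum_firstArrival_eq_zero_of_forall_mem hm₂, sum_firstArrival_eq_zero_of_forall_mem hm₂,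
    sum_firstArrival_eq_single γ₀ h₀ huniq, sum_firstArrival_eq_single γ₀ h₀ huniq] at H
  -- the slit domain of `[u]` is `Λ ∖ u`
  have hdom : (Λ \ γ₀.verts.toFinset).erase v = (Λ.erase u).erase v := by
    rw [hγ₀, List.toFinset_cons, List.toFinset_nil, Finset.insert_empty,
      Finset.sdiff_singleton_eq_erase]
  rw [loopSum_congr hdom] at H
  have hlen : γ₀.length = 1 := by
    simp [HexMidEdgeSAW.length, hγ₀]
  simp only [mul_zero, add_zero, norm_mul, Complex.norm_real, Real.norm_eq_abs,
    HexMidEdgeSAW.norm_weight _ hx.le, hlen, pow_one] at H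
  set Z : ℝ := ∑ δ : HexMidEdgeSAW ((Λ.erase u).erase v) s(v, w₁) s(v, w₂),
    hexCriticalFugacity ^ δ.length with hZ
  have hZ0 : 0 ≤ Z := Finset.sum_nonneg fun _ _ => pow_nonneg hx.le _
  have hβ : 0 ≤ 1 + 2 * hexCriticalFugacity * Real.cos (11 * Real.pi / 24) := nfb_betaT_nonneg
  have h3 : 0 < Real.sqrt 3 := Real.sqrt_pos.2 (by norm_num)
  rw [abs_of_nonneg (by positivity)] at H
  have H' : hexCriticalFugacity *
      ((1 + 2 * hexCriticalFugacity * Real.cos (11 * Real.pi / 24)) +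
        Real.sqrt 3 * hexCriticalFugacity * Z) ≤
      hexCriticalFugacity * (k * |(1 + 2 * hexCriticalFugacity * Real.cos (5 * Real.pi / 24)) -
        Real.sqrt 3 * hexCriticalFugacity * Z|) := by
    linarith [H]
  exact le_of_mul_le_mul_left H' hx

/-- **Slit coherence implies the source-loop bound on pendant-source domains.** If slit coherence
holds with some `k < 1` (the registered stub `stub_slitCoherence`, verbatim), then there is
`c < sin(π/8)` such that for every simply connected `Λ`, every boundary mid-edge `{t, u}` whose
vertex `u ∈ Λ` is pendant with inner neighbour `v`, and the two other neighbours `w₁ ≠ w₂` of `v`,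
the critical returning-loop series of `(Λ ∖ u) ∖ v` from `{v, w₁}` to `{v, w₂}` is at most `c` —
the statement of the item `SourceLoopBound` (stmt-CriticalPhenomena-8300) for the domain `Λ ∖ u`
at the boundary mid-edge `{u, v}`, restricted to the configurations in which `u` can be adjoined
as a pendant vertex (all half-plane configurations among them). The constant is
`c = max 0 ((kα_T − β_T)/((1+k)√3 x_c))`, and `c < sin(π/8)` is `k < 1`
(`α_T − β_T = 2√3 x_c sin(π/8)`). [folklore] -/
theorem sourceLoopBoundPendant_of_slitCoherence
    (hCoh : ∃ k : ℝ, k < 1 ∧ ∀ (Λ : Finset HexVertex), hexDomainSimplyConnected Λ →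
      ∀ a ∈ hexDomainBoundary Λ, ∀ v ∈ Λ, v ∉ a → (∀ u : HexVertex, hexGraph.Adj v u → u ∈ Λ) →
      ∀ w₀ w₁ w₂ : HexVertex, hexGraph.Adj v w₀ → hexGraph.Adj v w₁ → hexGraph.Adj v w₂ →
      w₀ ≠ w₁ → w₁ ≠ w₂ → w₀ ≠ w₂ →
      winding [hexMidpoint s(w₀, v), hexCenter v, hexMidpoint s(v, w₁)] = Real.pi / 3 →
      let x : ℝ := hexCriticalFugacity
      let α : ℝ := 1 + 2 * hexCriticalFugacity * Real.cos (5 * Real.pi / 24)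
      let β : ℝ := 1 + 2 * hexCriticalFugacity * Real.cos (11 * Real.pi / 24)
      let ω : ℂ := Complex.exp (2 * Real.pi * Complex.I / 3)
      let Z : (w p q : HexVertex) → HexMidEdgeSAW Λ a s(v, w) → ℝ :=
        fun w p q (γ : HexMidEdgeSAW Λ a s(v, w)) =>
        ∑ δ : HexMidEdgeSAW ((Λ \ γ.verts.toFinset).erase v) s(v, p) s(v, q), x ^ δ.length
      let B : (w p q : HexVertex) → ℂ := fun w p q =>
        ∑ γ : HexMidEdgeSAW Λ a s(v, w), if v ∉ γ.verts then
          γ.weight x (5 / 8) * ((β + Real.sqrt 3 * x * Z w p q γ : ℝ) : ℂ) else 0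
      let S : (w p q : HexVertex) → ℂ := fun w p q =>
        ∑ γ : HexMidEdgeSAW Λ a s(v, w), if v ∉ γ.verts then
          γ.weight x (5 / 8) * ((α - Real.sqrt 3 * x * Z w p q γ : ℝ) : ℂ) else 0
      ‖B w₀ w₁ w₂ + ω * B w₁ w₂ w₀ + ω ^ 2 * B w₂ w₀ w₁‖ ≤
        k * ‖S w₀ w₁ w₂ + S w₁ w₂ w₀ + S w₂ w₀ w₁‖) :
    ∃ c : ℝ, c < Real.sin (Real.pi / 8) ∧ ∀ (Λ : Finset HexVertex), hexDomainSimplyConnected Λ →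
      ∀ t u v w₁ w₂ : HexVertex, t ∉ Λ → u ∈ Λ → v ∈ Λ → hexGraph.Adj u t → hexGraph.Adj v u →
      (∀ y : HexVertex, hexGraph.Adj u y → y ∈ Λ → y = v) →
      hexGraph.Adj v w₁ → hexGraph.Adj v w₂ → u ≠ w₁ → u ≠ w₂ → w₁ ≠ w₂ →
      (∑ δ : HexMidEdgeSAW ((Λ.erase u).erase v) s(v, w₁) s(v, w₂),
        hexCriticalFugacity ^ δ.length) ≤ c := by
  obtain ⟨k, hk1, H⟩ := hCoh
  set α : ℝ := 1 + 2 * hexCriticalFugacity * Real.cos (5 * Real.pi / 24) with hα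
  set β : ℝ := 1 + 2 * hexCriticalFugacity * Real.cos (11 * Real.pi / 24) with hβ
  have hαpos : 0 < α := nfb_alphaT_pos
  have hβnn : 0 ≤ β := nfb_betaT_nonneg
  have hx : 0 < hexCriticalFugacity := nfb_xc_pos
  have h3 : 0 < Real.sqrt 3 := Real.sqrt_pos.2 (by norm_num)
  have hαβ : α - β = 2 * Real.sqrt 3 * hexCriticalFugacity * Real.sin (Real.pi / 8) :=
    alphaT_sub_betaT
  have hβpos : 0 < β := by
    have hc : 0 < Real.cos (11 * Real.pi / 24) := Real.cos_pos_of_mem_Ioo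
      ⟨by linarith [Real.pi_pos], by linarith [Real.pi_pos]⟩
    rw [hβ]
    positivity
  -- the constant
  refine ⟨if -1 < k then max 0 ((k * α - β) / ((1 + k) * (Real.sqrt 3 * hexCriticalFugacity)))
    else 0, ?_, ?_⟩
  · have hs : 0 < Real.sin (Real.pi / 8) := Real.sin_pos_of_pos_of_lt_pi (by positivity)
      (by linarith [Real.pi_pos])
    split_ifs with hk
    · refine max_lt hs ?_
      have hden : 0 < (1 + k) * (Real.sqrt 3 * hexCriticalFugacity) := by
        have : 0 < 1 + k := by linarith
        positivity
      rw [div_lt_iff₀ hden]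
      have e : Real.sin (Real.pi / 8) * ((1 + k) * (Real.sqrt 3 * hexCriticalFugacity)) =
          (1 + k) * (α - β) / 2 := by
        rw [hαβ]; ring
      rw [e]
      nlinarith [mul_pos (sub_pos.2 hk1) (add_pos_of_pos_of_nonneg hαpos hβnn)]
    · exact hs
  · intro Λ hΛ t u v w₁ w₂ ht hu hv htu huv hpend h₁ h₂ hu₁ hu₂ h₁₂
    set Z : ℝ := ∑ δ : HexMidEdgeSAW ((Λ.erase u).erase v) s(v, w₁) s(v, w₂),
      hexCriticalFugacity ^ δ.length with hZ
    have hZ0 : 0 ≤ Z := Finset.sum_nonneg fun _ _ => pow_nonneg hx.le _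
    -- empty ports: the loop type is empty unless `w₁, w₂ ∈ Λ`
    have hvd : v ∉ (Λ.erase u).erase v := fun h => (Finset.mem_erase.1 h).1 rfl
    have hc0 : (0 : ℝ) ≤ if -1 < k then
        max 0 ((k * α - β) / ((1 + k) * (Real.sqrt 3 * hexCriticalFugacity))) else 0 := by
      split_ifs
      · exact le_max_left _ _
      · exact le_rfl
    have hZe : IsEmpty (HexMidEdgeSAW ((Λ.erase u).erase v) s(v, w₁) s(v, w₂)) → Z = 0 :=
      fun _ => by rw [hZ]; simp
    have hout : ∀ {w : HexVertex}, w ∉ Λ → w ∉ (Λ.erase u).erase v := fun hw h =>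
      hw (Finset.mem_of_mem_erase (Finset.mem_of_mem_erase h))
    by_cases hw₁ : w₁ ∈ Λ
    swap
    · rw [hZe (isEmpty_saw_of_notMem_fst (z := s(v, w₂)) hvd (hout hw₁))]
      exact hc0
    by_cases hw₂ : w₂ ∈ Λ
    swap
    · have hne : s(v, w₁) ≠ s(v, w₂) := by
        rw [Ne, Sym2.eq_iff]
        rintro (⟨-, h⟩ | ⟨h, -⟩)
        · exact h₁₂ h
        · exact h₂.ne h
      rw [hZe (isEmpty_saw_of_notMem (a := s(v, w₁)) hvd (hout hw₂) hne)]
      exact hc0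
    -- the inequality in the positive labelling, transported to `(w₁, w₂)` by reciprocity
    have key : β + Real.sqrt 3 * hexCriticalFugacity * Z ≤
        k * |α - Real.sqrt 3 * hexCriticalFugacity * Z| := by
      obtain ⟨ε, hε, T1, -, -, -, -, T6⟩ := stub_localTurns v u w₁ w₂ huv h₁ h₂ hu₁ h₁₂ hu₂
      rcases hε with rfl | rfl
      · rw [one_mul] at T1
        exact pendant_loop_ineq H hΛ ht hu hv htu huv hpend h₁ h₂ hu₁ hu₂ h₁₂ hw₁ hw₂ T1
      · rw [neg_mul, one_mul, neg_neg] at T6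
        have h := pendant_loop_ineq H hΛ ht hu hv htu huv hpend h₂ h₁ hu₂ hu₁ h₁₂.symm hw₂ hw₁ T6
        rwa [loopSum_symm (Λ := Λ.erase u) h₁ h₂ h₁₂] at h
    -- `β + √3 x Z ≤ k |α − √3 x Z|` forces `k > 0`, `α − √3 x Z ≥ 0` and then `Z ≤ c`
    have hkpos : 0 < k := by
      by_contra hk
      push Not at hk
      have : k * |α - Real.sqrt 3 * hexCriticalFugacity * Z| ≤ 0 :=
        mul_nonpos_of_nonpos_of_nonneg hk (abs_nonneg _)
      nlinarith [key, mul_nonneg (mul_nonneg h3.le hx.le) hZ0]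
    rw [if_pos (by linarith)]
    refine le_trans ?_ (le_max_right _ _)
    have hden : 0 < (1 + k) * (Real.sqrt 3 * hexCriticalFugacity) := by positivity
    by_cases hsgn : 0 ≤ α - Real.sqrt 3 * hexCriticalFugacity * Z
    · rw [abs_of_nonneg hsgn] at key
      rw [le_div_iff₀ hden]
      nlinarith [key]
    · push Not at hsgn
      rw [abs_of_neg hsgn] at key
      nlinarith [key, mul_pos h3 hx, hZ0]

/-- **`NoFoldBound` implies the source-loop bound on pendant-source domains, through slit coherence
alone** (composition of the landed `slitCoherence_of_noFoldBound` with
`sourceLoopBoundPendant_of_slitCoherence`; the direct route through the source vertex is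
`sourceLoopBound_of_noFoldBound`). [folklore] -/
theorem sourceLoopBoundPendant_of_noFoldBound
    (h : Summit.CriticalPhenomena.SAWScalingLimit.Theses.SAWDevelopingMap.NoFoldBound) :
    ∃ c : ℝ, c < Real.sin (Real.pi / 8) ∧ ∀ (Λ : Finset HexVertex), hexDomainSimplyConnected Λ →
      ∀ t u v w₁ w₂ : HexVertex, t ∉ Λ → u ∈ Λ → v ∈ Λ → hexGraph.Adj u t → hexGraph.Adj v u →
      (∀ y : HexVertex, hexGraph.Adj u y → y ∈ Λ → y = v) →
      hexGraph.Adj v w₁ → hexGraph.Adj v w₂ → u ≠ w₁ → u ≠ w₂ → w₁ ≠ w₂ →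
      (∑ δ : HexMidEdgeSAW ((Λ.erase u).erase v) s(v, w₁) s(v, w₂),
        hexCriticalFugacity ^ δ.length) ≤ c :=
  sourceLoopBoundPendant_of_slitCoherence (slitCoherence_of_noFoldBound stub_portRenewal stub_slitSC h)

end Summit.CriticalPhenomena.SAWScalingLimit.Theorems.SAWDevelopingMapNoFoldBound
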